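import Summits.KontsevichZagierPeriods.Zeta5Search.Barrier.ConeGammaGapTour
import Summits.KontsevichZagierPeriods.Zeta5Search.Barrier.ConeGammaPeriodDigamma

/-!
# ζ(5) search — BARRIER: a kernel CHECKER for the gap data of `N_a` on one period (integer directions)

HONEST FRAMING (cell `pub-zeta5`): systematic search; no irrationality claim unless kernel-certified. MODEL objects
under Brown–Zudilin's (28)+(30) accounting ([BZ22] = arXiv:2210.03391); nothing here is a statement about `ζ(5)`;
records in print UNMOVED. Part 2/3 of the kernel evaluation of `Φ(a)` at ONE integer direction (seat P2 g13;
`BARRIER-PLAN.md` §2b item (d)). «Certificate table + checker» shape: the finite computation behind the `hΦ`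
hypotheses of the record/flag/ridge pins is replaced by a TABLE (one `GapRec` per gap of the period `[0,1]` of
`N_a`) and ONE Boolean test `gapsCheck a table`, evaluated by the kernel (`decide`), with a soundness theorem.

* `s2 a`, `pf2 a i j` — `2·s(a)` and the doubled pair forms of an INTEGER parameter vector (integers);
  `sParam_realDir`, `pairForm_sParam_realDir`; `boxCheck` / `BZBox_of_boxCheck`.
* `GapRec` — a gap `(lo, next lo)` with: claimed value `c`, witness ordering `wit`, Held–Karp certificate `(D, Y, L)`
  (`ConeGammaGapTour.hkValid`); `gapTab` — the gap's floor table `⌊lo · pairForm⌋` (any table passing `floorCheck`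
  would do: the test, not the formula, is what the soundness proof uses).
* `gapsCheck a gs` — all tests; **`savingN_eq_of_gapsCheck`**: if it passes, `N_a(u) = c_m` on every open gap
  `(b_m, b_{m+1})` (`b_M = 1`); **`phi30_eq_of_gapsCheck`**: then
  `Φ(a) = Σ_{1 ≤ m < M} c_m · (ψ(b_{m+1}) − ψ(b_m))` (`ConeGammaPeriodDigamma.phi30_eq_digammaSum` with `T = 1`).
The numerical enclosure of the right-hand side is part 3/3 (`ConeGammaPhiDigammaCert`). (Module name `ConeGammaGapTable`: the name `ConeGammaGapCert` is taken by a parallel file of the theory seat built on the retired DP evaluator; nothing here imports it.)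
-/

noncomputable section

namespace Summit.KontsevichZagierPeriods.Zeta5Search.Barrier.ConeGamma

open Finset Set

/-! ### Integer directions -/

/-- `2·s(a)` for an integer parameter vector `a` (BZ §10 inverse transformation, doubled: integers). -/
def s2 (a : Fin 8 → ℤ) : Fin 8 → ℤ :=
  ![a 1 + a 2 + a 3, 2 * a 0 + a 1 - a 2 - a 3, a 2 + a 3 - a 1, a 1 + a 2 - a 3,
    2 * a 4 + a 3 - a 1 - a 2, 2 * a 7 + a 3 - a 1 - a 2, 2 * a 5 - 2 * a 7 + a 1 + a 2 - a 3,
    2 * a 6 + 2 * a 7 - 2 * a 5 + a 3 - a 1 - a 2]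

/-- `s(a) = s2(a)/2`. -/
theorem sParam_realDir (a : Fin 8 → ℤ) (i : Fin 8) : sParam (realDir a) i = (s2 a i : ℝ) / 2 := by
  fin_cases i <;> simp [sParam, realDir, s2] <;> ring

/-- The doubled pair form `2·pairForm (s(a)) i j` of an integer direction (an integer). -/
def pf2 (a : Fin 8 → ℤ) (i j : Fin 8) : ℤ :=
  if i = 0 then s2 a 0 - s2 a j else if j = 0 then s2 a 0 - s2 a i else s2 a i + s2 a j

/-- `pairForm (s(a)) i j = pf2 a i j / 2`. -/
theorem pairForm_sParam_realDir (a : Fin 8 → ℤ) (i j : Fin 8) :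
    pairForm (sParam (realDir a)) i j = (pf2 a i j : ℝ) / 2 := by
  unfold pairForm pf2
  split_ifs <;> simp [sParam_realDir] <;> ring

/-- Kernel test of `BZBox (realDir a)`: `0 < s₀`, `0 ≤ s_j ≤ s₀`. -/
def boxCheck (a : Fin 8 → ℤ) : Bool :=
  decide (0 < s2 a 0) && (List.finRange 7).all fun j => decide (0 ≤ s2 a j.succ) && decide (s2 a j.succ ≤ s2 a 0)

/-- A passed box test gives `BZBox`. -/
theorem BZBox_of_boxCheck {a : Fin 8 → ℤ} (h : boxCheck a = true) : BZBox (realDir a) := by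
  unfold boxCheck at h
  simp only [Bool.and_eq_true, decide_eq_true_eq, List.all_eq_true] at h
  obtain ⟨h0, hj⟩ := h
  refine ⟨?_, fun j => ?_⟩
  · rw [sParam_realDir]
    have h0' : (0 : ℝ) < s2 a 0 := by exact_mod_cast h0
    linarith
  · obtain ⟨h1, h2⟩ := hj j (List.mem_finRange j)
    have h1' : (0 : ℝ) ≤ s2 a j.succ := by exact_mod_cast h1
    have h2' : (s2 a j.succ : ℝ) ≤ s2 a 0 := by exact_mod_cast h2
    rw [sParam_realDir, sParam_realDir]
    constructor <;> linarith

/-! ### Gap records and the per-gap tests -/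

/-- One gap of the period of `N_a` on `[0,1]`, left endpoint `loN/loD` (the right endpoint is the next record's
left endpoint, or `1`): the claimed constant value `c` of `N_a` on the open gap, a witness `wit` (the images
`σ(0..6)` of an ordering attaining the maximum), and a Held–Karp dual certificate `(D, Y, L)`. -/
structure GapRec where
  /-- numerator of the left endpoint -/
  loN : ℕ
  /-- denominator of the left endpoint (positive) -/
  loD : ℕ
  /-- the value of `N_a` on the open gap -/
  c : ℕ
  /-- witness: images of `0,…,6` under an optimal `σ ∈ S₇` -/
  wit : List (Fin 7)
  /-- scaling of the dual certificate (`1` or `2` in practice) -/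
  D : ℕ
  /-- potentials `Y 0, …, Y 7` (scaled by `D`) -/
  Y : List ℤ
  /-- subtour / edge-cap multipliers (scaled by `D`) -/
  L : List (List (Fin 8) × ℕ)

/-- The record used past the end of a table: left endpoint `1`. -/
def GapRec.dflt : GapRec := ⟨1, 1, 0, [], 1, [], []⟩

/-- Breakpoint `b_m` of a table (`b_M = 1` past the end). -/
def bpt (gs : List GapRec) (m : ℕ) : ℝ := ((gs.getD m GapRec.dflt).loN : ℝ) / (gs.getD m GapRec.dflt).loD

/-- Gap value `c_m` of a table. -/
def cval (gs : List GapRec) (m : ℕ) : ℤ := (gs.getD m GapRec.dflt).c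

/-- The floor table of a gap: `⌊lo · pairForm (s(a))⌋` (left-endpoint floors; validated by `floorCheck`). -/
def gapTab (a : Fin 8 → ℤ) (g : GapRec) (i j : Fin 8) : ℤ := ((g.loN : ℤ) * pf2 a i j) / (2 * (g.loD : ℤ))

/-- Test that the floor table is the floor table of EVERY point of the open gap `(loN/loD, hiN/hiD)`:
for each `i ≠ j`, either `pf2 > 0 ∧ n ≤ lo·pf2/2 ∧ hi·pf2/2 ≤ n+1`, or `pf2 = 0 ∧ n = 0`. -/
def floorCheck (a : Fin 8 → ℤ) (g : GapRec) (hiN hiD : ℕ) : Bool :=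
  (List.finRange 8).all fun i => (List.finRange 8).all fun j => decide (i = j) ||
    ((decide (0 < pf2 a i j) && decide (2 * (g.loD : ℤ) * gapTab a g i j ≤ (g.loN : ℤ) * pf2 a i j) &&
        decide ((hiN : ℤ) * pf2 a i j ≤ 2 * (hiD : ℤ) * (gapTab a g i j + 1))) ||
      (decide (pf2 a i j = 0) && decide (gapTab a g i j = 0)))

/-- The witness as a map on `Fin 7`. -/
def witF (w : List (Fin 7)) (j : Fin 7) : Fin 7 := w.getD j.val 0

/-- The witness lifted to `Fin 8` (fixing `0`), as `liftPerm` does. -/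
def liftF (w : List (Fin 7)) : Fin 8 → Fin 8 := Fin.cases 0 fun j => (witF w j).succ

/-- Injectivity test of the witness. -/
def witInj (w : List (Fin 7)) : Bool :=
  (List.finRange 7).all fun i => (List.finRange 7).all fun j => decide (i = j) || !decide (witF w i = witF w j)

/-- The potentials as a function. -/
def Yf (g : GapRec) (i : Fin 8) : ℤ := g.Y.getD i.val 0

/-- All tests of one gap against the next left endpoint `hiN/hiD`. -/
def gapCheck (a : Fin 8 → ℤ) (g : GapRec) (hiN hiD : ℕ) : Bool :=
  decide (0 < g.loD) && decide (0 < hiD) && decide (g.loN * hiD < hiN * g.loD) && decide (0 < g.D) &&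
    floorCheck a g hiN hiD && witInj g.wit && hkValid (gapTab a g) g.D (Yf g) g.L &&
    decide (hkBound (Yf g) g.L < (g.D : ℤ) * ((g.c : ℤ) + tourValF (gapTab a g) id + 1)) &&
    decide (tourValF (gapTab a g) (liftF g.wit) = (g.c : ℤ) + tourValF (gapTab a g) id)

/-- All tests of a table: the box, `b₀ = 0`, and every gap against the next left endpoint. -/
def gapsCheck (a : Fin 8 → ℤ) (gs : List GapRec) : Bool :=
  boxCheck a && decide ((gs.getD 0 GapRec.dflt).loN = 0) &&
    (List.range gs.length).all fun m =>
      gapCheck a (gs.getD m GapRec.dflt) (gs.getD (m + 1) GapRec.dflt).loN (gs.getD (m + 1) GapRec.dflt).loD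

/-! ### Soundness of the per-gap tests -/

/-- Floors are constant on an open interval between consecutive breakpoints (integer form of the test). -/
theorem floor_eq_of_checks {p q p' q' : ℕ} (hq : 0 < q) (hq' : 0 < q') {x : ℤ} {n : ℤ} {u : ℝ}
    (hu1 : (p : ℝ) / q < u) (hu2 : u < (p' : ℝ) / q')
    (h : ((0 < x ∧ 2 * (q : ℤ) * n ≤ (p : ℤ) * x) ∧ (p' : ℤ) * x ≤ 2 * (q' : ℤ) * (n + 1)) ∨ (x = 0 ∧ n = 0)) :
    ⌊u * ((x : ℝ) / 2)⌋ = n := by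
  rcases h with ⟨⟨hx, h1⟩, h2⟩ | ⟨hx, hn⟩
  · have hqr : (0 : ℝ) < q := by exact_mod_cast hq
    have hqr' : (0 : ℝ) < q' := by exact_mod_cast hq'
    have hxr : (0 : ℝ) < x := by exact_mod_cast hx
    have h1r : 2 * (q : ℝ) * n ≤ (p : ℝ) * x := by exact_mod_cast h1
    have h2r : (p' : ℝ) * x ≤ 2 * (q' : ℝ) * (n + 1) := by exact_mod_cast h2
    rw [Int.floor_eq_iff]
    constructor
    · -- n ≤ (p/q)(x/2) < u x/2
      have hlo : (n : ℝ) ≤ (p : ℝ) / q * (x / 2) := by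
        rw [div_mul_div_comm, le_div_iff₀ (by positivity)]; linarith
      have : (p : ℝ) / q * (x / 2) < u * (x / 2) := mul_lt_mul_of_pos_right hu1 (by positivity)
      linarith
    · have hhi : (p' : ℝ) / q' * (x / 2) ≤ n + 1 := by
        rw [div_mul_div_comm, div_le_iff₀ (by positivity)]; linarith
      have : u * ((x : ℝ) / 2) < (p' : ℝ) / q' * (x / 2) := mul_lt_mul_of_pos_right hu2 (by positivity)
      linarith
  · subst hx; subst hn; simp

/-- Soundness of `floorCheck`: on the open gap the floor table of `u·s(a)` IS `gapTab`, off the diagonal. -/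
theorem floorTab_eq_of_floorCheck {a : Fin 8 → ℤ} {g : GapRec} {hiN hiD : ℕ} (hlo : 0 < g.loD) (hhi : 0 < hiD)
    (h : floorCheck a g hiN hiD = true) {u : ℝ} (hu : u ∈ Ioo ((g.loN : ℝ) / g.loD) ((hiN : ℝ) / hiD)) :
    ∀ i j : Fin 8, i ≠ j → floorTab (u • sParam (realDir a)) i j = gapTab a g i j := by
  intro i j hij
  unfold floorCheck at h
  simp only [List.all_eq_true, Bool.or_eq_true, decide_eq_true_eq, Bool.and_eq_true] at h
  rcases h i (List.mem_finRange i) j (List.mem_finRange j) with h | h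
  · exact absurd h hij
  · unfold floorTab
    rw [pairForm_smul, pairForm_sParam_realDir]
    exact floor_eq_of_checks hlo hhi hu.1 hu.2 h

/-- Soundness of `witInj`: the witness map is a bijection of `Fin 7`. -/
theorem witF_bijective {w : List (Fin 7)} (h : witInj w = true) : Function.Bijective (witF w) := by
  unfold witInj at h
  simp only [List.all_eq_true, Bool.or_eq_true, decide_eq_true_eq, Bool.not_eq_true', decide_eq_false_iff_not]
    at h
  have hinj : Function.Injective (witF w) := fun i j hij => by
    rcases h i (List.mem_finRange i) j (List.mem_finRange j) with h' | h'
    · exact h'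
    · exact absurd hij h'
  exact ⟨hinj, Finite.surjective_of_injective hinj⟩

/-- The witness permutation. -/
def witPerm {w : List (Fin 7)} (h : witInj w = true) : Equiv.Perm (Fin 7) :=
  Equiv.ofBijective (witF w) (witF_bijective h)

/-- `liftPerm` of the witness permutation is `liftF`. -/
theorem liftPerm_witPerm {w : List (Fin 7)} (h : witInj w = true) : ⇑(liftPerm (witPerm h)) = liftF w := by
  ext i
  refine Fin.cases ?_ (fun j => ?_) i
  · simp [liftF]
  · simp [liftF, witPerm]

/-- `liftPerm 1` is the identity map. -/
theorem liftPerm_one_coe : ⇑(liftPerm (1 : Equiv.Perm (Fin 7))) = id := by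
  ext i
  refine Fin.cases ?_ (fun j => ?_) i <;> simp

/-- **Soundness of `gapCheck`**: on the open gap, `N_a(u) = c`. -/
theorem savingN_eq_of_gapCheck {a : Fin 8 → ℤ} (ha : BZBox (realDir a)) {g : GapRec} {hiN hiD : ℕ}
    (h : gapCheck a g hiN hiD = true) {u : ℝ} (hu : u ∈ Ioo ((g.loN : ℝ) / g.loD) ((hiN : ℝ) / hiD)) :
    savingN (realDir a) u = g.c := by
  unfold gapCheck at h
  simp only [Bool.and_eq_true, decide_eq_true_eq] at h
  obtain ⟨⟨⟨⟨⟨⟨⟨⟨hlo, hhi⟩, _⟩, hD⟩, hfl⟩, hwit⟩, hhk⟩, hbd⟩, hw⟩ := h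
  rw [savingN_eq_torusN_of_BZBox ha]
  have hθ := floorTab_eq_of_floorCheck hlo hhi hfl hu
  have hwv : tourVal (gapTab a g) (witPerm hwit) = (g.c : ℤ) + tourValF (gapTab a g) id := by
    rw [tourVal, liftPerm_witPerm hwit, hw]
  rw [torusN_eq_of_cert hθ hD hhk hbd hwv, tourVal, liftPerm_one_coe]
  ring

/-! ### Soundness of the table test -/

/-- Past the end of the table the breakpoint is `1`. -/
theorem bpt_length (gs : List GapRec) : bpt gs gs.length = 1 := by
  simp [bpt, GapRec.dflt]

/-- **Soundness of `gapsCheck` (values)**: `N_a ≡ c_m` on every open gap `(b_m, b_{m+1})`. -/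
theorem savingN_eq_of_gapsCheck {a : Fin 8 → ℤ} {gs : List GapRec} (h : gapsCheck a gs = true) :
    ∀ m < gs.length, ∀ u ∈ Ioo (bpt gs m) (bpt gs (m + 1)), savingN (realDir a) u = cval gs m := by
  intro m hm u hu
  unfold gapsCheck at h
  simp only [Bool.and_eq_true, decide_eq_true_eq, List.all_eq_true, List.mem_range] at h
  obtain ⟨⟨hbox, _⟩, hall⟩ := h
  exact savingN_eq_of_gapCheck (BZBox_of_boxCheck hbox) (hall m hm) hu

/-- **Soundness of `gapsCheck` (breakpoints)**: `b₀ = 0`, `b_M = 1`, strictly increasing. -/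
theorem bpt_strictMono_of_gapsCheck {a : Fin 8 → ℤ} {gs : List GapRec} (h : gapsCheck a gs = true) :
    bpt gs 0 = 0 ∧ ∀ m < gs.length, bpt gs m < bpt gs (m + 1) := by
  unfold gapsCheck at h
  simp only [Bool.and_eq_true, decide_eq_true_eq, List.all_eq_true, List.mem_range] at h
  obtain ⟨⟨_, h0⟩, hall⟩ := h
  refine ⟨by unfold bpt; rw [h0]; simp, fun m hm => ?_⟩
  have hg := hall m hm
  unfold gapCheck at hg
  simp only [Bool.and_eq_true, decide_eq_true_eq] at hg
  obtain ⟨⟨⟨⟨⟨⟨⟨⟨hlo, hhi⟩, hlt⟩, _⟩, _⟩, _⟩, _⟩, _⟩, _⟩ := hg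
  unfold bpt
  rw [div_lt_div_iff₀ (by exact_mod_cast hlo) (by exact_mod_cast hhi)]
  exact_mod_cast hlt

/-- **The exact period formula at an integer direction, given a passed table**:
`Φ(a) = Σ_{1 ≤ m < M} c_m · (ψ(b_{m+1}) − ψ(b_m))` (`T = 1`: `h_k(a) ∈ ℤ`). -/
theorem phi30_eq_of_gapsCheck {a : Fin 8 → ℤ} {gs : List GapRec} (h : gapsCheck a gs = true) :
    phi30 (realDir a) = ∑ m ∈ Finset.Ico 1 gs.length, (cval gs m : ℝ) *
      (Complex.digamma ((bpt gs (m + 1) : ℝ) : ℂ) - Complex.digamma ((bpt gs m : ℝ) : ℂ)).re := by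
  have hg := h
  unfold gapsCheck at hg
  simp only [Bool.and_eq_true, decide_eq_true_eq, List.all_eq_true, List.mem_range] at hg
  have ha : BZBox (realDir a) := BZBox_of_boxCheck hg.1.1
  obtain ⟨hb0, hb⟩ := bpt_strictMono_of_gapsCheck h
  have hper : ∀ k : Fin 28, ∃ z : ℤ, (1 : ℝ) * h28 (realDir a) k = z := fun k =>
    ⟨Literature.NumberTheory.Irrationality.BrownZudilin2022.hForm a (k + 1), by rw [one_mul, h28_realDir]⟩
  have hmain := phi30_eq_digammaSum ha one_pos hper (M := gs.length) (b := bpt gs) hb0 (bpt_length gs) hb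
    (c := cval gs) (savingN_eq_of_gapsCheck h)
  simpa only [div_one] using hmain

end Summit.KontsevichZagierPeriods.Zeta5Search.Barrier.ConeGamma

end
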